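import Mathlib.Analysis.SpecialFunctions.Gamma.Basic
import Literature.Analysis.UnboundedOperators.HeatKernel
import Literature.MathematicalPhysics.QuantumManyBody.PeriodicBoseGasLemma32
import HarnessLib

/-!
# The smeared, zero-mean, periodic Riesz kernel by heat-kernel subordination

Trunk T-KINETIC / StatisticalMechanics. Definition request `defn-PeriodicRieszKernel` of route
`AtomisticToContinuum/BECRieszLadder` (items `RieszKernelPositiveType`, `RieszJastrowCondensate`,
which inline the term defined here).

## The kernel

For an exponent `s` (intended `0 < s < 3`), a side `L > 0` and a smearing length `η > 0`,

  `g_{s,L,η}(x) = K_s ∫_{η²}^{∞} t^{(1-s)/2} ( Σ_{m ∈ ℤ³} G_t(x - L m) - L⁻³ ) dt`,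
  `K_s = (4π)^{3/2} 4^{-s/2} / Γ(s/2)`,

where `G_t(x) = (4πt)^{-3/2} e^{-|x|²/4t}` is the heat kernel of `ℝ³`
(`Literature.Analysis.UnboundedOperators.heatKernel`) and `L m` the lattice vector
(`Literature.MathematicalPhysics.QuantumManyBody.BoseGas.latticeVec`). RATIONALE (subordination,
Stein, *Singular Integrals*, Ch. V §1; Riesz gases: Lewin 2022 survey, Serfaty 2024 lectures
Ch. 3–4): `K_s ∫_0^∞ t^{(1-s)/2} G_t(x) dt = |x|^{-s}` on `ℝ³` (the substitution `u = |x|²/4t`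
gives `(4π)^{-3/2} 4^{s/2} Γ(s/2) |x|^{-s}`; `s = 1`: `K_1 = 4π`, `4π ∫_0^∞ G_t(x) dt = 1/|x|`, cf.
`BoseGas.lintegral_Ioi_heatKernel`; `s = 2`: `K_2 = 2π^{3/2}`), so truncating the `t`-integral at
`η²` smears the singularity at scale `η`, periodising `G_t` over `Lℤ³` makes the kernel
`Lℤ³`-periodic, and subtracting the cell average `L⁻³` of `Σ_m G_t(· - Lm)` makes it integrate to
zero over the cell (zero Fourier mode), whence — by the theta/Poisson identity
`Σ_m G_t(x - Lm) = L⁻³ Σ_{k ∈ (2π/L)ℤ³} e^{-t|k|²} e^{ik·x}` — the Fourier coefficients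
`ĝ(k) = K_s ∫_{η²}^∞ t^{(1-s)/2} e^{-t|k|²} dt > 0` (`k ≠ 0`), `ĝ(0) = 0`: `g` is conditionally
positive definite and obeys Onsager's bound `Σ_{i<j} g(X_i - X_j) ≥ -N g(0)/2`, with the
self-energy `0 < g(0) ≤ C_s η^{-s}` uniformly in `L`.

## What is here

The definition (`rieszSubordinationConst`, `periodicHeatSum`, `periodicRieszKernel`) with the
signature requested, `periodicRieszKernel (s L η : ℝ) : EuclideanSpace ℝ (Fin 3) → ℝ`, and the
elementary symmetries PROVED: evenness (`periodicRieszKernel_neg`) and `Lℤ³`-periodicity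
(`periodicRieszKernel_add_latticeVec`), via the corresponding properties of the periodised heat
sum (reindexing the `ℤ³`-sum). NOT here (the request's items (a) continuity/smoothness, (b) the
theta identity, positive type and Onsager's lemma, (c) the self-energy bound, (d) asymptotics):
these are theorems of analysis to be proved or cited separately; no named fact is introduced.
Junk values: the `t`-integral is a Bochner integral over `(η², ∞)` (convergent for `η ≠ 0` and
every real `s`; for `η = 0` and `s ≥ 1` it diverges at `t → 0` on the lattice and the value is
the junk `0`); `Γ(s/2) = 0` never occurs for `s > 0`.

## Sources

* E. M. Stein, *Singular Integrals and Differentiability Properties of Functions* (1970), Ch. V §1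
  (Riesz potentials, subordination to the heat/Poisson semigroup).
* M. Lewin, *Coulomb and Riesz gases: the known and the unknown*, J. Math. Phys. 63 (2022)
  (arXiv:2202.09240), §§ on periodic Riesz energies.
* S. Serfaty, *Lectures on Coulomb and Riesz gases* (arXiv:2407.21194), Ch. 3–4 (truncation /
  smearing of the kernel, Onsager's lemma).
-/

noncomputable section

namespace Literature.MathematicalPhysics.StatisticalMechanics

open MeasureTheory Real
open Literature.Analysis.UnboundedOperators Literature.MathematicalPhysics.QuantumManyBody.BoseGas

/-- The subordination constant `K_s = (4π)^{3/2} 4^{-s/2} / Γ(s/2)`, normalised so that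
`K_s ∫_0^∞ t^{(1-s)/2} G_t(x) dt = |x|^{-s}` on `ℝ³` (`K_1 = 4π`, `K_2 = 2π^{3/2}`).
Stein, *Singular Integrals*, Ch. V §1 (subordination of Riesz potentials). [folklore] -/
def rieszSubordinationConst (s : ℝ) : ℝ :=
  (4 * π) ^ (3 / 2 : ℝ) * (4 : ℝ) ^ (-(s / 2)) / Real.Gamma (s / 2)

/-- The `Lℤ³`-periodised heat kernel with its cell average removed:
`Θ_{L,t}(x) = Σ_{m ∈ ℤ³} G_t(x - L m) - L⁻³` (a real `tsum`; summable for `t > 0`). Its cell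
integral vanishes and, by the theta identity, `Θ_{L,t}(x) = L⁻³ Σ_{k ≠ 0} e^{-t|k|²} e^{ik·x}`,
`k ∈ (2π/L)ℤ³` (not proved here). [folklore] -/
def periodicHeatSum (L t : ℝ) (x : EuclideanSpace ℝ (Fin 3)) : ℝ :=
  (∑' m : Fin 3 → ℤ, heatKernel t (x - latticeVec L m)) - 1 / L ^ 3

/-- **The smeared, zero-mean, `Lℤ³`-periodic Riesz-`s` kernel** (heat-kernel subordination
truncated at `t = η²`):
`periodicRieszKernel s L η x = K_s ∫_{t ∈ (η², ∞)} t^{(1-s)/2} (Σ_{m ∈ ℤ³} G_t(x - Lm) - L⁻³) dt`,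
the term inlined in route `BECRieszLadder` (items `RieszKernelPositiveType`,
`RieszJastrowCondensate`); intended for `0 < s < 3`, `L > 0`, `η > 0`. As `η → 0` and `L → ∞` it
approaches `|x|^{-s}`; for `η > 0` it is bounded (self-energy `g(0) ≤ C_s η^{-s}` uniformly in
`L`), even, `Lℤ³`-periodic and of zero cell mean. Stein, *Singular Integrals*, Ch. V §1; Lewin
(2022); Serfaty (2024) Ch. 3–4. [folklore] -/
def periodicRieszKernel (s L η : ℝ) : EuclideanSpace ℝ (Fin 3) → ℝ := fun x =>
  rieszSubordinationConst s *
    ∫ t in Set.Ioi (η ^ 2), t ^ ((1 - s) / 2) * periodicHeatSum L t x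

/-! ### API: unfolding, evenness, periodicity -/

/-- Unfolding `periodicRieszKernel` into the requested inline form. [folklore] -/
theorem periodicRieszKernel_apply (s L η : ℝ) (x : EuclideanSpace ℝ (Fin 3)) :
    periodicRieszKernel s L η x =
      rieszSubordinationConst s *
        ∫ t in Set.Ioi (η ^ 2), t ^ ((1 - s) / 2) *
          ((∑' m : Fin 3 → ℤ, heatKernel t (x - latticeVec L m)) - 1 / L ^ 3) :=
  rfl

/-- The heat kernel is even. Evans, *PDE*, §2.3.1. [folklore] -/
theorem heatKernel_neg' (t : ℝ) (z : EuclideanSpace ℝ (Fin 3)) : heatKernel t (-z) = heatKernel t z := by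
  unfold heatKernel
  rw [norm_neg]

/-- The periodised heat sum is even: `Θ(-x) = Θ(x)` (reindex `m ↦ -m`). [folklore] -/
theorem periodicHeatSum_neg (L t : ℝ) (x : EuclideanSpace ℝ (Fin 3)) :
    periodicHeatSum L t (-x) = periodicHeatSum L t x := by
  unfold periodicHeatSum
  congr 1
  rw [← (Equiv.neg (Fin 3 → ℤ)).tsum_eq]
  refine tsum_congr fun m => ?_
  rw [Equiv.neg_apply, latticeVec_neg, sub_neg_eq_add, ← heatKernel_neg' t, neg_add, ← sub_eq_add_neg,
    neg_neg]

/-- The periodised heat sum is `Lℤ³`-periodic: `Θ(x + Ln) = Θ(x)` (reindex `m ↦ m + n`). [folklore] -/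
theorem periodicHeatSum_add_latticeVec (L t : ℝ) (x : EuclideanSpace ℝ (Fin 3)) (n : Fin 3 → ℤ) :
    periodicHeatSum L t (x + latticeVec L n) = periodicHeatSum L t x := by
  unfold periodicHeatSum
  congr 1
  rw [← (Equiv.addRight n).tsum_eq]
  refine tsum_congr fun m => ?_
  rw [Equiv.coe_addRight, latticeVec_add]
  congr 1
  abel

/-- **Evenness**: `g(-x) = g(x)`. [folklore] -/
theorem periodicRieszKernel_neg (s L η : ℝ) (x : EuclideanSpace ℝ (Fin 3)) :
    periodicRieszKernel s L η (-x) = periodicRieszKernel s L η x := by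
  simp only [periodicRieszKernel, periodicHeatSum_neg]

/-- **`Lℤ³`-periodicity**: `g(x + L n) = g(x)` for `n ∈ ℤ³`. [folklore] -/
theorem periodicRieszKernel_add_latticeVec (s L η : ℝ) (x : EuclideanSpace ℝ (Fin 3)) (n : Fin 3 → ℤ) :
    periodicRieszKernel s L η (x + latticeVec L n) = periodicRieszKernel s L η x := by
  simp only [periodicRieszKernel, periodicHeatSum_add_latticeVec]

/-- Periodicity in the subtractive form `g(x - L n) = g(x)`. [folklore] -/
theorem periodicRieszKernel_sub_latticeVec (s L η : ℝ) (x : EuclideanSpace ℝ (Fin 3)) (n : Fin 3 → ℤ) :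
    periodicRieszKernel s L η (x - latticeVec L n) = periodicRieszKernel s L η x := by
  rw [sub_eq_add_neg, ← latticeVec_neg, periodicRieszKernel_add_latticeVec]

/-- The pair kernel is symmetric: `g(x - y) = g(y - x)`. [folklore] -/
theorem periodicRieszKernel_sub_comm (s L η : ℝ) (x y : EuclideanSpace ℝ (Fin 3)) :
    periodicRieszKernel s L η (x - y) = periodicRieszKernel s L η (y - x) := by
  rw [← neg_sub, periodicRieszKernel_neg]

/-- The subordination constant at `s = 1` is `4π` (`Γ(1/2) = √π`, `(4π)^{3/2} 4^{-1/2} = 4π √π`),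
matching `4π ∫_0^∞ G_t(x) dt = 1/|x|` (`BoseGas.lintegral_Ioi_heatKernel`). [folklore] -/
theorem rieszSubordinationConst_one : rieszSubordinationConst 1 = 4 * π := by
  rw [rieszSubordinationConst, show ((1 : ℝ) / 2) = 1 / 2 from rfl, Real.Gamma_one_half_eq]
  have hπ : 0 < π := Real.pi_pos
  have h4π : (0 : ℝ) ≤ 4 * π := by positivity
  have h32 : (4 * π) ^ (3 / 2 : ℝ) = 4 * π * Real.sqrt (4 * π) := by
    rw [show (3 / 2 : ℝ) = 1 + 1 / 2 by norm_num, Real.rpow_add (by positivity), Real.rpow_one,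
      Real.sqrt_eq_rpow]
  have h4 : (4 : ℝ) ^ (-((1 : ℝ) / 2)) = 1 / 2 := by
    rw [Real.rpow_neg (by norm_num), ← Real.sqrt_eq_rpow, show (4 : ℝ) = 2 ^ 2 by norm_num,
      Real.sqrt_sq (by norm_num)]
    norm_num
  rw [h32, h4, Real.sqrt_mul' _ hπ.le, show (4 : ℝ) = 2 ^ 2 by norm_num, Real.sqrt_sq (by norm_num)]
  have hsπ : Real.sqrt π ≠ 0 := (Real.sqrt_pos.2 hπ).ne'
  field_simp

end Literature.MathematicalPhysics.StatisticalMechanics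

end
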